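import Literature.NumberTheory.Rogawski1990.LocalNormFibreNonsplit                -- ★ p08: `charpoly_endoEmbLocal`, `IsLocalNormPair.isRoot_finGammaTwo`, `.isRegularElt`
import Literature.NumberTheory.Rogawski1990.QuasiSplitRankTwoPrescribedCharpoly     -- ★ (KS-2a) at the FIELD level: `exists_unitaryGroup_antidiagTwo_charpoly_mul_X_sub_C_eq`
import Literature.NumberTheory.Automorphic.LocalUnitaryGroupCongr                   -- ★ `localNonsplitEquiv` (one-place model), `antidiagOne_eq_over`, `isUnit_placeForm_of_isUnit_det`
import Literature.NumberTheory.Automorphic.LocalUnitaryIntegralLevel                -- ★ `placeForm_antidiagOne`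
import Literature.NumberTheory.Automorphic.UnitaryGroupInertPlaceHyperbolicBasis    -- ★ `galAdicCompletionMap_galAdicCompletionMap_of_smul_eq` (`σ_w² = 1`)
import Literature.NumberTheory.Automorphic.SatakeW0SymmetryAdicCompletion           -- ★ `exists_galAdicCompletionMap_ne` (`σ_w ≠ id`)
import HarnessLib

/-!
# NORM SURJECTIVITY onto the root locus at a non-split place: every regular `γ ∈ U(H′)(L⁺_v)` whose characteristic polynomial has a
# norm-one root `u ∈ L_w¹` is matched by a `G`-regular `γ_H = (g, u) ∈ H_v = U(Φ₂)(L⁺_v) × U(Φ₁)(L⁺_v)` (Rogawski 1990, §3.2 Thm. 3.2.1, §5.4 (5.4.5))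

Topic `NumberTheory/Rogawski1990`; namespace `Literature.NumberTheory.Rogawski1990`.  THEOREMS ONLY (no definition, no instance, no notation, no named fact,
no `sorry`; count-neutral for the books).  Cell `pub/hodgecm-mathlib` (D-0151), crux H413 = stmt-HodgeConjecture-24833, F0∕P3a road «D-N6-ns», floor-1 target
«N6-ns-reg»; brick **(J-e-2) «NORM SURJECTIVITY onto the root locus»** of F0P3a-p08 (g13)'s ledger `LEDGER-N6ns-floor1` §2 ∕ F0P2-p02 (g8) 2026-09-01T02:48:38Z;
consumer = the junction `Rogawski1990/LocalTransferChartJunctionCM.lean` (its `hcov`: the matched charts together with the (J-e-1) «no norm-one root» charts cover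
`G′_v^{reg}`).  Sibling of ★ `LocalNormFibreNonsplit` (the fibre has ≤ 3 stable classes); this file says the fibre is NON-EMPTY over every admissible root.
HONEST LABEL: HC_CM is proved only modulo the printed citations until rung 0 closes; this file proves no letter.

THE MATHEMATICS.  The engine is ★ `QuasiSplitRankTwoPrescribedCharpoly` (KS-2a) over a FIELD with a non-trivial involution `σ`: for `γ ∈ U(σ, H)`, `det H ≠ 0`, and
a root `β` of `charpoly γ` with `β σβ = 1`, the quotient `charpoly γ ∕ (X − β)` is σ-reciprocal and is the characteristic polynomial of an EXPLICIT element of the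
quasi-split `U(Φ₂)` (★ `exists_unitaryGroup_antidiagTwo_charpoly_mul_X_sub_C_eq`).  At a non-split place `v` of `L⁺` (`w ∣ v`, `c • w = w`) the local carriers
`(cmDatum L N H).Local v ≤ GL_N(Π_{w′∣v} L_{w′})` are the one-place models `U(σ_w, H_w)(L_w)` over the local FIELD `L_w` (★ `UnitaryGroup.localNonsplitEquiv`,
`g ↦ g_w`, `σ_w = galAdicCompletionMap c hw` an involution ≠ id, `H_w = placeForm H w`), characteristic polynomials map along `eval_w` (§1), and `eval_w` is
INJECTIVE on `Π_{w′∣v} L_{w′}` (one factor).  So: read `γ` and `z ∈ U(Φ₁)(L⁺_v)` in the models (§2: `u_w σ_w(u_w) = 1`), run (KS-2a) in `L_w`, pull the witness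
back along the model of `U(Φ₂)(L⁺_v)` (the model form of `Φ₂` IS `Φ₂`, ★ `placeForm_antidiagOne`), and descend the polynomial identity
`charpoly g · (X − u) = charpoly γ` from `L_w` to `Π L_{w′}` (§3).  Then `charpoly ι_v(g, z) = charpoly g · (X − u) = charpoly γ` (★ `charpoly_endoEmbLocal`) is
separable, so `ι_v(g, z)` and `γ` are conjugate in `GL₃(Π L_{w′})` (★ `exists_units_conj_eq_of_charpoly_eq_of_separable`) — that IS `IsLocalNormPair` — and
`(g, z)` is `G`-regular (§4).  §5 packages the dichotomy the junction's cover needs: a regular `γ` is matched iff `charpoly γ` has a root `u(z)`, `z ∈ U(Φ₁)(L⁺_v)`.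

* §1 `evalRingHom_placesOver_injective`, `charpoly_localNonsplitEquiv`, `coe_localNonsplitEquiv_symm_map`.
* §2 `map_apply_mul_apply_eq_one_of_local_one` (the `U(1)`-slot is a local norm-one element), `exists_local_one_apply_eq` (converse, every `v`).
* §3 **`exists_local_antidiagTwo_charpoly_mul_X_sub_C_eq`** — (KS-2a) on the local carriers.
* §4 **`exists_isLocalGRegular_isLocalNormPair_of_isRoot`** (HEAD), `exists_isLocalNormPair_of_isRoot_of_map_mul_eq_one` (`finGammaTwo` currency).
* §5 **`exists_isLocalGRegular_isLocalNormPair_iff`** — matched ⟺ regular with a root on the `U(1)`-locus (the contrapositive packaging on the unmatched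
  locus is ★ `not_isLocalNormPair_of_forall_not_isRoot` of `LocalTransferUnmatchedLocus`, (J-e-1); not restated).

## References
* [Rogawski1990] J. D. Rogawski, *Automorphic Representations of Unitary Groups in Three Variables*, Ann. of Math. Stud. 123 (1990): §3.2 Thm. 3.2.1 p. 20
  (Kottwitz–Steinberg: stable classes of a quasi-split group have rational points), §4.3 (4.3.1) p. 43, §5.4 (5.4.5) pp. 72–74, 78 (the classes of `H` over `𝒪_st(γ)`).
* [PlatonovRapinchuk1994] V. Platonov, A. Rapinchuk, *Algebraic Groups and Number Theory* (1994), §5.1 (`G(F_v)` of a matrix realisation; `E ⊗_F F_v = E_w` at a non-split `v`).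
-/

set_option autoImplicit false

noncomputable section

open NumberField IsDedekindDomain Matrix Polynomial
open scoped MatrixGroups

namespace Literature.NumberTheory.Rogawski1990

open Literature.NumberTheory.Automorphic
open Literature.AlgebraicGeometry.ShimuraVarieties (unitaryGroup)

variable (L : Type) [Field L] [NumberField L] [IsCMField L] (H' : Matrix (Fin 3) (Fin 3) L)
  (v : HeightOneSpectrum (𝓞 ↥(maximalRealSubfield L))) (w : UnitaryGroup.PlacesOver L v) (hw : IsCMField.complexConj L • w.1 = w.1)

/-! ## §1 One-place model bookkeeping at a non-split place: `eval_w` is injective, characteristic polynomials map along it -/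

section Model

variable {N : ℕ} (H : Matrix (Fin N) (Fin N) L)

include hw in
/-- At a non-split place (`c • w = w`, so `w` is the ONLY place above `v`, ★ `PlacesOver.subsingleton_of_smul_eq`) the projection
`Π_{w′ ∣ v} L_{w′} → L_w` is injective. [cite: PlatonovRapinchuk1994, §5.1] -/
theorem evalRingHom_placesOver_injective :
    Function.Injective (Pi.evalRingHom (fun w' : UnitaryGroup.PlacesOver L v => w'.1.adicCompletion L) w) := by
  haveI := UnitaryGroup.PlacesOver.subsingleton_of_smul_eq (IsCMField.complexConj L) (IsCMField.complexConj_ne_one L) w hw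
  intro x y h
  funext w'
  rw [Subsingleton.elim w' w]
  exact h

/-- The matrix of the one-place model `g_w ∈ U(σ_w, H_w)(L_w)` of `g ∈ U(H)(L⁺_v)` is the `w`-component of the matrix of `g` (definitional, ★ `localNonsplitEquiv`).
[cite: PlatonovRapinchuk1994, §5.1] -/
theorem coe_localNonsplitEquiv_eq_map (g : (UnitaryGroup.cmDatum L N H).Local v) :
    (((UnitaryGroup.localNonsplitEquiv (IsCMField.complexConj L) H (IsCMField.complexConj_ne_one L) w hw g :
        unitaryGroupOfForm (galAdicCompletionMap (L := L) (IsCMField.complexConj L) hw) (UnitaryGroup.placeForm H w.1)) :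
        GL (Fin N) (w.1.adicCompletion L)) : Matrix (Fin N) (Fin N) (w.1.adicCompletion L)) =
      ((g.val : GL (Fin N) (UnitaryGroup.LocalRing L v)) : Matrix (Fin N) (Fin N) (UnitaryGroup.LocalRing L v)).map
        (Pi.evalRingHom (fun w' : UnitaryGroup.PlacesOver L v => w'.1.adicCompletion L) w) :=
  rfl

/-- **`charpoly g_w = (charpoly g).map eval_w`** for the one-place model (Mathlib `Matrix.charpoly_map`). [cite: PlatonovRapinchuk1994, §5.1] -/
theorem charpoly_localNonsplitEquiv (g : (UnitaryGroup.cmDatum L N H).Local v) :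
    (((UnitaryGroup.localNonsplitEquiv (IsCMField.complexConj L) H (IsCMField.complexConj_ne_one L) w hw g :
        unitaryGroupOfForm (galAdicCompletionMap (L := L) (IsCMField.complexConj L) hw) (UnitaryGroup.placeForm H w.1)) :
        GL (Fin N) (w.1.adicCompletion L)) : Matrix (Fin N) (Fin N) (w.1.adicCompletion L)).charpoly =
      (((g.val : GL (Fin N) (UnitaryGroup.LocalRing L v)) : Matrix (Fin N) (Fin N) (UnitaryGroup.LocalRing L v)).charpoly).map
        (Pi.evalRingHom (fun w' : UnitaryGroup.PlacesOver L v => w'.1.adicCompletion L) w) := by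
  rw [coe_localNonsplitEquiv_eq_map, Matrix.charpoly_map]

/-- The same for an element GIVEN in the model: `(charpoly (e.symm x)).map eval_w = charpoly x`. [cite: PlatonovRapinchuk1994, §5.1] -/
theorem charpoly_map_localNonsplitEquiv_symm
    (x : unitaryGroupOfForm (galAdicCompletionMap (L := L) (IsCMField.complexConj L) hw) (UnitaryGroup.placeForm H w.1)) :
    (((((UnitaryGroup.localNonsplitEquiv (IsCMField.complexConj L) H (IsCMField.complexConj_ne_one L) w hw).symm x :
        (UnitaryGroup.cmDatum L N H).Local v).val : GL (Fin N) (UnitaryGroup.LocalRing L v)) :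
        Matrix (Fin N) (Fin N) (UnitaryGroup.LocalRing L v)).charpoly).map
        (Pi.evalRingHom (fun w' : UnitaryGroup.PlacesOver L v => w'.1.adicCompletion L) w) =
      ((x : GL (Fin N) (w.1.adicCompletion L)) : Matrix (Fin N) (Fin N) (w.1.adicCompletion L)).charpoly := by
  rw [← charpoly_localNonsplitEquiv, ContinuousMulEquiv.apply_symm_apply]

end Model

/-! ## §2 The `U(1)`-slot: `u = z₀₀` is a local norm-one element -/

section Slot

/-- For `z ∈ U(Φ₁)(L⁺_v)` at a non-split place, the `w`-component `u_w` of its entry `u = z₀₀` satisfies `u_w · σ_w(u_w) = 1` in `L_w` (read in the one-place model: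
the model form of `Φ₁ = (1)` is `(1)`, ★ `placeForm_antidiagOne`). [cite: Rogawski1990, §3.5 p. 29] [cite: PlatonovRapinchuk1994, §5.1] -/
theorem apply_mul_map_apply_eq_one_of_local_one
    (z : (UnitaryGroup.cmDatum L 1 (Matrix.of fun i j : Fin 1 => if i.val + j.val + 1 = 1 then (1 : L) else 0)).Local v) :
    ((z.val : GL (Fin 1) (UnitaryGroup.LocalRing L v)) : Matrix (Fin 1) (Fin 1) (UnitaryGroup.LocalRing L v)) 0 0 w *
        galAdicCompletionMap (L := L) (IsCMField.complexConj L) hw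
          (((z.val : GL (Fin 1) (UnitaryGroup.LocalRing L v)) : Matrix (Fin 1) (Fin 1) (UnitaryGroup.LocalRing L v)) 0 0 w) = 1 := by
  set x := UnitaryGroup.localNonsplitEquiv (IsCMField.complexConj L)
    (Matrix.of fun i j : Fin 1 => if i.val + j.val + 1 = 1 then (1 : L) else 0) (IsCMField.complexConj_ne_one L) w hw z with hx
  have hcoe : ((x : GL (Fin 1) (w.1.adicCompletion L)) : Matrix (Fin 1) (Fin 1) (w.1.adicCompletion L)) 0 0 =
      ((z.val : GL (Fin 1) (UnitaryGroup.LocalRing L v)) : Matrix (Fin 1) (Fin 1) (UnitaryGroup.LocalRing L v)) 0 0 w := rfl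
  set M : Matrix (Fin 1) (Fin 1) (w.1.adicCompletion L) := ((x : GL (Fin 1) (w.1.adicCompletion L)) : Matrix (Fin 1) (Fin 1) (w.1.adicCompletion L))
    with hM
  have hmem : (M.map (galAdicCompletionMap (L := L) (IsCMField.complexConj L) hw))ᵀ *
      UnitaryGroup.placeForm (Matrix.of fun i j : Fin 1 => if i.val + j.val + 1 = 1 then (1 : L) else 0) w.1 * M =
      UnitaryGroup.placeForm (Matrix.of fun i j : Fin 1 => if i.val + j.val + 1 = 1 then (1 : L) else 0) w.1 :=
    (mem_unitaryGroupOfForm_iff).1 x.2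
  have h00 := congrArg (fun A : Matrix (Fin 1) (Fin 1) (w.1.adicCompletion L) => A 0 0) hmem
  simp only [UnitaryGroup.placeForm, Matrix.mul_apply, Fin.sum_univ_one, Matrix.transpose_apply, Matrix.map_apply, Matrix.of_apply,
    Fin.val_zero, zero_add, if_true, map_one, mul_one] at h00
  rw [← hcoe, mul_comm]
  exact h00

/-- Conversely (every finite `v`): a unit `u ∈ Π_{w∣v} L_w` with `(c ⊗ 1)(u) · u = 1` is the entry of an element of `U(Φ₁)(L⁺_v)`. [cite: Rogawski1990, §3.5 p. 29] -/
theorem exists_local_one_apply_eq (u : UnitaryGroup.LocalRing L v) (hu : IsUnit u)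
    (h1 : UnitaryGroup.conjLocal L (IsCMField.complexConj L) v u * u = 1) :
    ∃ z : (UnitaryGroup.cmDatum L 1 (Matrix.of fun i j : Fin 1 => if i.val + j.val + 1 = 1 then (1 : L) else 0)).Local v,
      ((z.val : GL (Fin 1) (UnitaryGroup.LocalRing L v)) : Matrix (Fin 1) (Fin 1) (UnitaryGroup.LocalRing L v)) 0 0 = u := by
  have hM : IsUnit (Matrix.diagonal (fun _ : Fin 1 => u)) := by
    rw [Matrix.isUnit_iff_isUnit_det, Matrix.det_diagonal, Fin.prod_univ_one]; exact hu
  refine ⟨⟨hM.unit, ?_⟩, ?_⟩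
  · change hM.unit ∈ UnitaryGroup.«local» L (IsCMField.complexConj L) 1 _ v
    rw [UnitaryGroup.local_eq_unitaryGroupOfForm_map, mem_unitaryGroupOfForm_iff, IsUnit.unit_spec]
    refine Matrix.ext fun i j => ?_
    fin_cases i; fin_cases j
    simp only [Matrix.mul_apply, Fin.sum_univ_one, Matrix.transpose_apply, Matrix.map_apply, Matrix.of_apply,
      Fin.isValue, Fin.val_zero, zero_add, if_true, map_one, mul_one]
    exact h1
  · rw [IsUnit.unit_spec, Matrix.diagonal_apply_eq]

end Slot

/-! ## §3 (KS-2a) on the local carriers: `∃ g ∈ U(Φ₂)(L⁺_v)` with `charpoly g · (X − u) = charpoly γ` -/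

section Witness

set_option maxHeartbeats 400000 in
include hw in
/-- **Kottwitz–Steinberg for `U(Φ₂)(L⁺_v)` at a non-split place, prescribed quotient.**  For `γ ∈ U(H′)(L⁺_v)` (`IsUnit H′.det`; no regularity, no hermitian
hypothesis needed) and `z ∈ U(Φ₁)(L⁺_v)` whose entry `u = z₀₀` is a root of `charpoly γ`, there is `g ∈ U(Φ₂)(L⁺_v)` with `charpoly g · (X − u) = charpoly γ` in
`(Π_{w∣v} L_w)[X]`: the FIELD witness of ★ `exists_unitaryGroup_antidiagTwo_charpoly_mul_X_sub_C_eq` in the one-place model over `L_w` (`σ_w` is a non-trivial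
involution, `u_w σ_w(u_w) = 1` by §2, `det H′_w ≠ 0`), pulled back along the model of `U(Φ₂)(L⁺_v)` (its form IS `Φ₂`, ★ `placeForm_antidiagOne`), the identity
descended from `L_w` by injectivity of `eval_w` (§1). [cite: Rogawski1990, §3.2 Thm. 3.2.1 p. 20; §5.4 (5.4.5) p. 74] [cite: PlatonovRapinchuk1994, §5.1] -/
theorem exists_local_antidiagTwo_charpoly_mul_X_sub_C_eq (hH'd : IsUnit H'.det) (γ : (UnitaryGroup.cmDatum L 3 H').Local v)
    (z : (UnitaryGroup.cmDatum L 1 (Matrix.of fun i j : Fin 1 => if i.val + j.val + 1 = 1 then (1 : L) else 0)).Local v)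
    (hz : (((γ.val : GL (Fin 3) (UnitaryGroup.LocalRing L v)) : Matrix (Fin 3) (Fin 3) (UnitaryGroup.LocalRing L v)).charpoly).IsRoot
      (((z.val : GL (Fin 1) (UnitaryGroup.LocalRing L v)) : Matrix (Fin 1) (Fin 1) (UnitaryGroup.LocalRing L v)) 0 0)) :
    ∃ g : (UnitaryGroup.cmDatum L 2 (Matrix.of fun i j : Fin 2 => if i.val + j.val + 1 = 2 then (1 : L) else 0)).Local v,
      ((g.val : GL (Fin 2) (UnitaryGroup.LocalRing L v)) : Matrix (Fin 2) (Fin 2) (UnitaryGroup.LocalRing L v)).charpoly *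
          (X - C (((z.val : GL (Fin 1) (UnitaryGroup.LocalRing L v)) : Matrix (Fin 1) (Fin 1) (UnitaryGroup.LocalRing L v)) 0 0)) =
        ((γ.val : GL (Fin 3) (UnitaryGroup.LocalRing L v)) : Matrix (Fin 3) (Fin 3) (UnitaryGroup.LocalRing L v)).charpoly := by
  have hc : IsCMField.complexConj L ≠ 1 := IsCMField.complexConj_ne_one L
  have hσσ : ∀ x, galAdicCompletionMap (L := L) (IsCMField.complexConj L) hw (galAdicCompletionMap (L := L) (IsCMField.complexConj L) hw x) = x :=
    UnitaryGroup.galAdicCompletionMap_galAdicCompletionMap_of_smul_eq (IsCMField.complexConj L) w hc hw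
  have hσ : ∃ x, galAdicCompletionMap (L := L) (IsCMField.complexConj L) hw x ≠ x :=
    UnitaryGroup.exists_galAdicCompletionMap_ne (IsCMField.complexConj L) hc v w hw
  have hdet : (UnitaryGroup.placeForm H' w.1).det ≠ 0 :=
    ((Matrix.isUnit_iff_isUnit_det _).1 (UnitaryGroup.isUnit_placeForm_of_isUnit_det hH'd w.1)).ne_zero
  -- `γ_w ∈ U(σ_w, H′_w)(L_w)`
  set γw : unitaryGroup (galAdicCompletionMap (L := L) (IsCMField.complexConj L) hw) (UnitaryGroup.placeForm H' w.1) :=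
    ⟨((UnitaryGroup.localNonsplitEquiv (IsCMField.complexConj L) H' hc w hw γ :
        unitaryGroupOfForm (galAdicCompletionMap (L := L) (IsCMField.complexConj L) hw) (UnitaryGroup.placeForm H' w.1)) :
        GL (Fin 3) (w.1.adicCompletion L)),
      (Literature.AlgebraicGeometry.ShimuraVarieties.mem_unitaryGroup_iff).2
        ((mem_unitaryGroupOfForm_iff).1 (UnitaryGroup.localNonsplitEquiv (IsCMField.complexConj L) H' hc w hw γ).2)⟩ with hγw
  -- the root `u_w` in `L_w`, of norm one
  set β : w.1.adicCompletion L :=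
    ((z.val : GL (Fin 1) (UnitaryGroup.LocalRing L v)) : Matrix (Fin 1) (Fin 1) (UnitaryGroup.LocalRing L v)) 0 0 w with hβdef
  have hβ : ((((γw : GL (Fin 3) (w.1.adicCompletion L)) : Matrix (Fin 3) (Fin 3) (w.1.adicCompletion L)).charpoly)).IsRoot β := by
    have h := hz.map (f := Pi.evalRingHom (fun w' : UnitaryGroup.PlacesOver L v => w'.1.adicCompletion L) w)
    rw [← charpoly_localNonsplitEquiv L v w hw H' γ] at h
    exact h
  have hβ1 : β * galAdicCompletionMap (L := L) (IsCMField.complexConj L) hw β = 1 :=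
    apply_mul_map_apply_eq_one_of_local_one L v w hw z
  -- (KS-2a) over the field `L_w`
  obtain ⟨γ₂, hγ₂⟩ := exists_unitaryGroup_antidiagTwo_charpoly_mul_X_sub_C_eq
    (galAdicCompletionMap (L := L) (IsCMField.complexConj L) hw) hσσ hσ hdet γw hβ hβ1
  -- the model form of `Φ₂` IS `Φ₂`
  have hΦ : UnitaryGroup.placeForm (Matrix.of fun i j : Fin 2 => if i.val + j.val + 1 = 2 then (1 : L) else 0) w.1 =
      (Matrix.of fun i j : Fin 2 => if i.val + j.val + 1 = 2 then (1 : w.1.adicCompletion L) else 0) := by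
    rw [UnitaryGroup.placeForm_antidiagOne, UnitaryGroup.antidiagOne_eq_over]
  have hmem : (γ₂ : GL (Fin 2) (w.1.adicCompletion L)) ∈
      unitaryGroupOfForm (galAdicCompletionMap (L := L) (IsCMField.complexConj L) hw)
        (UnitaryGroup.placeForm (Matrix.of fun i j : Fin 2 => if i.val + j.val + 1 = 2 then (1 : L) else 0) w.1) := by
    rw [mem_unitaryGroupOfForm_iff, hΦ]
    exact (Literature.AlgebraicGeometry.ShimuraVarieties.mem_unitaryGroup_iff).1 γ₂.2
  refine ⟨(UnitaryGroup.localNonsplitEquiv (IsCMField.complexConj L)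
      (Matrix.of fun i j : Fin 2 => if i.val + j.val + 1 = 2 then (1 : L) else 0) hc w hw).symm ⟨_, hmem⟩, ?_⟩
  -- descend the polynomial identity from `L_w` to `Π_{w′∣v} L_{w′}`
  apply Polynomial.map_injective _ (evalRingHom_placesOver_injective L v w hw)
  rw [Polynomial.map_mul, Polynomial.map_sub, Polynomial.map_X, Polynomial.map_C, charpoly_map_localNonsplitEquiv_symm,
    ← charpoly_localNonsplitEquiv L v w hw H' γ]
  exact hγ₂

end Witness

/-! ## §4 THE HEAD: every regular `γ` with a root on the `U(1)`-locus is matched by a `G`-regular `γ_H` -/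

section Head

include hw in
/-- **(J-e-2) NORM SURJECTIVITY ONTO THE ROOT LOCUS (non-split `v`).**  For `γ ∈ G′_v = U(H′)(L⁺_v)` REGULAR (`IsUnit H′.det`) and `z ∈ U(Φ₁)(L⁺_v)` whose entry
`u = z₀₀` is a root of `charpoly γ`, there is `g ∈ U(Φ₂)(L⁺_v)` with `γ_H := (g, z)` `G`-REGULAR and MATCHING `γ` (`ι_v(γ_H) ↔ γ`): by §3 `charpoly ι_v(g, z) =
charpoly g · (X − u) = charpoly γ` (★ `charpoly_endoEmbLocal`) is separable, and two elements of `GL₃(Π_{w∣v} L_w)` with the same SEPARABLE characteristic polynomial are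
conjugate (★ `exists_units_conj_eq_of_charpoly_eq_of_separable`).  With ★ `IsLocalNormPair.isRoot_finGammaTwo` (the converse) this is the pointwise content of the
junction's cover `G′_v^{reg} = (matched) ∪ (no norm-one root)`. [cite: Rogawski1990, §5.4 (5.4.5) pp. 72–74, 78; §3.2 Thm. 3.2.1 p. 20] -/
theorem exists_isLocalGRegular_isLocalNormPair_of_isRoot (hH'd : IsUnit H'.det) (γ : (UnitaryGroup.cmDatum L 3 H').Local v)
    (hγ : IsRegularElt (γ.val : GL (Fin 3) (UnitaryGroup.LocalRing L v)))
    (z : (UnitaryGroup.cmDatum L 1 (Matrix.of fun i j : Fin 1 => if i.val + j.val + 1 = 1 then (1 : L) else 0)).Local v)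
    (hz : (((γ.val : GL (Fin 3) (UnitaryGroup.LocalRing L v)) : Matrix (Fin 3) (Fin 3) (UnitaryGroup.LocalRing L v)).charpoly).IsRoot
      (((z.val : GL (Fin 1) (UnitaryGroup.LocalRing L v)) : Matrix (Fin 1) (Fin 1) (UnitaryGroup.LocalRing L v)) 0 0)) :
    ∃ g : (UnitaryGroup.cmDatum L 2 (Matrix.of fun i j : Fin 2 => if i.val + j.val + 1 = 2 then (1 : L) else 0)).Local v,
      IsLocalGRegular L v (g, z) ∧ IsLocalNormPair L H' v (g, z) γ := by
  obtain ⟨g, hg⟩ := exists_local_antidiagTwo_charpoly_mul_X_sub_C_eq L H' v w hw hH'd γ z hz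
  -- `charpoly ι_v(g, z) = charpoly γ`
  have hchar : ((endoEmbLocal L v (g, z)).val.val : Matrix (Fin 3) (Fin 3) (UnitaryGroup.LocalRing L v)).charpoly =
      ((γ.val : GL (Fin 3) (UnitaryGroup.LocalRing L v)) : Matrix (Fin 3) (Fin 3) (UnitaryGroup.LocalRing L v)).charpoly := by
    rw [charpoly_endoEmbLocal]
    exact hg
  have hreg : IsLocalGRegular L v (g, z) := by
    change (((endoEmbLocal L v (g, z)).val.val : Matrix (Fin 3) (Fin 3) (UnitaryGroup.LocalRing L v)).charpoly).Separable
    rw [hchar]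
    exact hγ
  refine ⟨g, hreg, ?_⟩
  obtain ⟨x, hx⟩ := Literature.LinearAlgebra.Matrix.exists_units_conj_eq_of_charpoly_eq_of_separable
    (K := fun w' : UnitaryGroup.PlacesOver L v => w'.1.adicCompletion L)
    ((endoEmbLocal L v (g, z)).val : GL (Fin 3) (UnitaryGroup.LocalRing L v)) (γ.val : GL (Fin 3) (UnitaryGroup.LocalRing L v))
    hreg hchar.symm
  rw [isLocalNormPair_iff]
  exact isConj_iff.2 ⟨x, hx⟩

include hw in
/-- **(J-e-2) in `finGammaTwo` currency**: for `γ` regular and a UNIT `u ∈ Π_{w∣v} L_w` with `(c ⊗ 1)(u) · u = 1` which is a root of `charpoly γ`, some `G`-regular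
`γ_H` with `U(1)`-slot `u` (★ `finGammaTwo L v γ_H = u`) matches `γ`. [cite: Rogawski1990, §5.4 (5.4.5) pp. 72–74, 78] -/
theorem exists_isLocalNormPair_of_isRoot_of_map_mul_eq_one (hH'd : IsUnit H'.det) (γ : (UnitaryGroup.cmDatum L 3 H').Local v)
    (hγ : IsRegularElt (γ.val : GL (Fin 3) (UnitaryGroup.LocalRing L v))) (u : UnitaryGroup.LocalRing L v) (hu : IsUnit u)
    (hu1 : UnitaryGroup.conjLocal L (IsCMField.complexConj L) v u * u = 1)
    (hroot : (((γ.val : GL (Fin 3) (UnitaryGroup.LocalRing L v)) : Matrix (Fin 3) (Fin 3) (UnitaryGroup.LocalRing L v)).charpoly).IsRoot u) :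
    ∃ γH : (UnitaryGroup.cmDatum L 2 (Matrix.of fun i j : Fin 2 => if i.val + j.val + 1 = 2 then (1 : L) else 0)).Local v ×
        (UnitaryGroup.cmDatum L 1 (Matrix.of fun i j : Fin 1 => if i.val + j.val + 1 = 1 then (1 : L) else 0)).Local v,
      finGammaTwo L v γH = u ∧ IsLocalGRegular L v γH ∧ IsLocalNormPair L H' v γH γ := by
  obtain ⟨z, hzu⟩ := exists_local_one_apply_eq L v u hu hu1
  obtain ⟨g, hreg, hmatch⟩ := exists_isLocalGRegular_isLocalNormPair_of_isRoot L H' v w hw hH'd γ hγ z (by rw [hzu]; exact hroot)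
  exact ⟨(g, z), hzu, hreg, hmatch⟩

end Head

/-! ## §5 The dichotomy for the junction's cover: matched ⟺ regular with a root on the `U(1)`-locus -/

section Dichotomy

include hw in
/-- **A class of `G′_v` is matched by a `G`-regular class of `H_v` iff it is regular and its characteristic polynomial has a root `u = z₀₀`, `z ∈ U(Φ₁)(L⁺_v)`**
(non-split `v`, `IsUnit H′.det`).  ⇒: ★ `IsLocalNormPair.isRegularElt` and ★ `IsLocalNormPair.isRoot_finGammaTwo` at `z := γ_H.2`; ⇐: §4.  For the (HLOC)-CM junction this
reads `G′_v^{reg} = {matched} ⊔ ({γ | ∀ z, ¬ IsRoot (charpoly γ) (u z)} ∩ reg)` — the matched charts and the (J-e-1) charts cover the regular set.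
[cite: Rogawski1990, §5.4 (5.4.5) pp. 72–74, 78; §4.3 (4.3.1) p. 43] -/
theorem exists_isLocalGRegular_isLocalNormPair_iff (hH'd : IsUnit H'.det) (γ : (UnitaryGroup.cmDatum L 3 H').Local v) :
    (∃ γH : (UnitaryGroup.cmDatum L 2 (Matrix.of fun i j : Fin 2 => if i.val + j.val + 1 = 2 then (1 : L) else 0)).Local v ×
        (UnitaryGroup.cmDatum L 1 (Matrix.of fun i j : Fin 1 => if i.val + j.val + 1 = 1 then (1 : L) else 0)).Local v,
        IsLocalGRegular L v γH ∧ IsLocalNormPair L H' v γH γ) ↔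
      IsRegularElt (γ.val : GL (Fin 3) (UnitaryGroup.LocalRing L v)) ∧
        ∃ z : (UnitaryGroup.cmDatum L 1 (Matrix.of fun i j : Fin 1 => if i.val + j.val + 1 = 1 then (1 : L) else 0)).Local v,
          (((γ.val : GL (Fin 3) (UnitaryGroup.LocalRing L v)) : Matrix (Fin 3) (Fin 3) (UnitaryGroup.LocalRing L v)).charpoly).IsRoot
            (((z.val : GL (Fin 1) (UnitaryGroup.LocalRing L v)) : Matrix (Fin 1) (Fin 1) (UnitaryGroup.LocalRing L v)) 0 0) := by
  constructor
  · rintro ⟨γH, hreg, hmatch⟩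
    exact ⟨IsLocalNormPair.isRegularElt L H' v hreg hmatch, γH.2, IsLocalNormPair.isRoot_finGammaTwo L H' v hmatch⟩
  · rintro ⟨hγ, z, hz⟩
    obtain ⟨g, hreg, hmatch⟩ := exists_isLocalGRegular_isLocalNormPair_of_isRoot L H' v w hw hH'd γ hγ z hz
    exact ⟨(g, z), hreg, hmatch⟩

end Dichotomy

end Literature.NumberTheory.Rogawski1990

end
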